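import Summits.ABC.StewartYu.KummerBasisChange
import Literature.Barriers.ABC.BakerMethodBoundsYuInputProofs
import HarnessLib

/-!
# Cell abc-stewartyu, Gen-3 frame at odd `p` (crux `Y07Odd`, stmt-ABC-19658): MATVEEV'S INDUCTION SHELL —
# the rank-indexed internal statement, the per-rank dichotomy, and the frozen engine text from the core

`Summits/ABC/StewartYu/GenThreeInductionOdd.lean` — cell `abc-stewartyu` (HOME
`run/shared/lean/pub/abc-stewartyu/`), route `PadicPrimesKummerThird`, seat p4 (g3), engine-support seat;
the odd-`p` TWIN of p3-g5's `Summits/ABC/StewartYu/GenThreeInductionTwo.lean` (same architecture, same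
names with `Odd` for `Two`).  Theorems and three plain `Prop`-valued definitions (the interface of record
D-F1 of HOME/plan/m3/ZE-INTERFACE.md §F at odd `p`, typed); no named fact, place-light (the only `p`-adic
input is the monotonicity `ord_p(x − 1) ≤ ord_p(xᵏ − 1)` for a `p`-adic unit `x`,
`Literature.Barriers.ABC.padicValRat_sub_one_le_zpow_sub_one`).

## What this file pins down

Matveev's `cⁿ`-quality bound is an INDUCTION ON THE NUMBER OF LOGARITHMS (Nesterenko 2003, Thm 2.1 via
Prop. 2.6; Yu 2007 at a finite place): at rank `n` the analytic frame either proves the bound or — through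
the zero estimate's obstruction subgroup, the lattice lever and the re-basing of the character lattice
(`Summit.ABC.StewartYu.MatveevStepData.exists_matveev_step_data`, `q = 2`) — produces a new linear form in
`r < n` logarithms `θᵢ = ∏ⱼ αⱼ^{Zᵢⱼ}` with `∏ θᵢ^{mᵢ} = (∏ αⱼ^{bⱼ})^{m₀}`, `m₀ ≠ 0`, and the cost inequality
`C(r)·∏A′·(W′ + log p + log 2A′max) ≤ C(n)·∏V·(W + log p + log 2Vmax)` (the record's (5.22) line).  Since
`ord_p((∏ αᵇ)^{m₀} − 1) ≥ ord_p(∏ αᵇ − 1)` for a `p`-adic unit, the induction hypothesis at rank `r` closes.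

The internal statement at odd `p` (D-F1): `CoreOdd C p r` — RATIONAL `p`-adic units `θᵢ` (`θᵢ ≠ 0`,
`ord_p θᵢ = 0`), multiplicatively independent, SIGNED `2`-Kummer in `ℤ`-divisibility form
(`∏ θᵢ^{κᵢ} = ±γ² ⇒ 2 ∣ κ`; `−1` is the torsion of `ℚˣ`), weights `h(θᵢ) ≤ Aᵢ`, floor `1 ≤ Aᵢ` (the
frame-friendly floor, as in the `p = 2` twin; the frozen text's `p`-independent floor `log 2 ≤ Vⱼ` is
reached by the rescaling `V ↦ V / log 2` in `engineOdd_of_core`, absorbed into `c₁ ↦ 2c₁ / log 2`),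
`Aᵢ ≤ Amax`, exponents `m ≠ 0` with `log max(3,|mᵢ|) ≤ W`, `1 ≤ W`; conclusion in the engine's currency
`ord_p(∏ θᵢ^{mᵢ} − 1) · log p ≤ C(r) · (p / log p) · ∏ Aᵢ · (W + log p + log 2Amax)`.
`StepOdd` = the data of one Matveev step, `DichotomyOdd` = bound-or-step at rank `n`.

Theorems (this file): `core_of_dichotomy` (strong induction on the rank), `dichotomyOdd_of_not_le` (the
frame's working form), `unit_prod_zpow`, `zpow_prod_zpow_ne_one`, `padicValRat_le_of_pow_eq` /
`stepOdd_of_pow_eq` (the step from the algebraic relation).  The sequel `GenThreeInductionOddEngine.lean`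
(same namespace) carries the dictionary between the frozen text's SUBSET form of the Kummer condition
(`¬ IsSquare (±∏_{j∈T} αⱼ)`, `T ≠ ∅`) and the signed divisibility form, and `engineOdd_of_core` /
`engineOdd_of_dichotomy`: the frozen `GenThreeEngineOdd` text of the birth skeleton of `Y07Odd`
(= hypothesis of `Summit.ABC.StewartYu.YuOhSeven.y07Odd_of_genThreeEngineOdd`) VERBATIM from
`∀ p prime ≠ 2, ∀ r, CoreOdd C p r`.  So the registered stub
`stub_engineOdd : Nesterenko2003_prop51 → GenThreeEngineOdd` is reduced, in the kernel, to
`∀ p prime ≠ 2, ∀ n, DichotomyOdd C p n` for one admissible `C ≤ c₁ⁿ`.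

WHAT THIS IS NOT: no analytic content; no crux moves; the cost inequality is the record's.

References: Yu. V. Nesterenko, *Linear forms in logarithms of rational numbers*, LNM 1819 (2003), Thm 2.1,
Prop. 2.6, §5.2 (5.22); K. Yu, *p-adic logarithmic forms and group varieties III*, Forum Math. 19 (2007),
Main Theorem (`K = ℚ`); K. Yu, Acta Math. 211 (2013), §2, §5.
-/

noncomputable section

open Finset

namespace Summit.ABC.StewartYu.GenThreeInductionOdd

/-! ### The rank-indexed internal statement and the step data (D-F1, odd `p`) -/

/-- **The internal induction statement of the odd-`p` Gen-3 engine at rank `r`** (D-F1): for rational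
`p`-adic units `θᵢ`, multiplicatively independent and signed `2`-Kummer (`ℤ`-divisibility form), weights
`h(θᵢ) ≤ Aᵢ`, `1 ≤ Aᵢ ≤ Amax`, exponents `m ≠ 0` with `log max(3,|mᵢ|) ≤ W`, `1 ≤ W`:
`ord_p(∏ θᵢ^{mᵢ} − 1)·log p ≤ C(r)·(p/log p)·∏ Aᵢ·(W + log p + log 2Amax)`.
[cite: Yu2007, Main Thm (K = ℚ); shape only] -/
def CoreOdd (C : ℕ → ℝ) (p r : ℕ) : Prop :=
  ∀ (θ : Fin r → ℚ) (m : Fin r → ℤ) (A : Fin r → ℝ) (Amax W : ℝ),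
    (∀ i, θ i ≠ 0 ∧ padicValRat p (θ i) = 0) →
    (∀ μ : Fin r → ℤ, ∏ i, θ i ^ μ i = 1 → μ = 0) →
    (∀ κ : Fin r → ℤ, (∃ γ : ℚ, ∏ i, θ i ^ κ i = γ ^ 2 ∨ ∏ i, θ i ^ κ i = -γ ^ 2) →
      ∀ i, (2 : ℤ) ∣ κ i) →
    (∀ i, Height.logHeight₁ (θ i) ≤ A i) → (∀ i, 1 ≤ A i) → (∀ i, A i ≤ Amax) →
    m ≠ 0 → (∀ i, Real.log (max 3 (|m i| : ℝ)) ≤ W) → 1 ≤ W →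
    (padicValRat p (∏ i, θ i ^ m i - 1) : ℝ) * Real.log p ≤
      C r * ((p : ℝ) / Real.log p) * (∏ i, A i) * (W + Real.log p + Real.log (2 * Amax))

/-- **The data of one Matveev step at rank `n`, odd `p`** (second branch of the dichotomy): a rank
`r < n`, new generators/exponents/weights satisfying every hypothesis of `CoreOdd C p r`, the valuation
comparison `ord_p(∏ αᵇ − 1) ≤ ord_p(∏ θᵐ − 1)`, and the cost inequality
`C(r)·∏A′·(W′ + log p + log 2A′max) ≤ C(n)·∏V·(W + log p + log 2Vmax)`.
[cite: Nesterenko2003, Prop 2.6 and (5.22)] -/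
def StepOdd (C : ℕ → ℝ) (p n : ℕ) (α : Fin n → ℚ) (b : Fin n → ℤ) (V : Fin n → ℝ) (Vmax W : ℝ) :
    Prop :=
  ∃ (r : ℕ) (θ : Fin r → ℚ) (m : Fin r → ℤ) (A : Fin r → ℝ) (Amax W' : ℝ), r < n ∧
    (∀ i, θ i ≠ 0 ∧ padicValRat p (θ i) = 0) ∧
    (∀ μ : Fin r → ℤ, ∏ i, θ i ^ μ i = 1 → μ = 0) ∧
    (∀ κ : Fin r → ℤ, (∃ γ : ℚ, ∏ i, θ i ^ κ i = γ ^ 2 ∨ ∏ i, θ i ^ κ i = -γ ^ 2) →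
      ∀ i, (2 : ℤ) ∣ κ i) ∧
    (∀ i, Height.logHeight₁ (θ i) ≤ A i) ∧ (∀ i, 1 ≤ A i) ∧ (∀ i, A i ≤ Amax) ∧
    m ≠ 0 ∧ (∀ i, Real.log (max 3 (|m i| : ℝ)) ≤ W') ∧ 1 ≤ W' ∧
    padicValRat p (∏ j, α j ^ b j - 1) ≤ padicValRat p (∏ i, θ i ^ m i - 1) ∧
    C r * (∏ i, A i) * (W' + Real.log p + Real.log (2 * Amax)) ≤
      C n * (∏ j, V j) * (W + Real.log p + Real.log (2 * Vmax))

/-- **The per-rank dichotomy at odd `p`** the analytic frame delivers at rank `n`: for every rank-`n`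
datum of `CoreOdd`, the bound holds or a Matveev step exists. [cite: Nesterenko2003, Prop 2.6] -/
def DichotomyOdd (C : ℕ → ℝ) (p n : ℕ) : Prop :=
  ∀ (α : Fin n → ℚ) (b : Fin n → ℤ) (V : Fin n → ℝ) (Vmax W : ℝ),
    (∀ j, α j ≠ 0 ∧ padicValRat p (α j) = 0) →
    (∀ μ : Fin n → ℤ, ∏ j, α j ^ μ j = 1 → μ = 0) →
    (∀ κ : Fin n → ℤ, (∃ γ : ℚ, ∏ j, α j ^ κ j = γ ^ 2 ∨ ∏ j, α j ^ κ j = -γ ^ 2) →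
      ∀ j, (2 : ℤ) ∣ κ j) →
    (∀ j, Height.logHeight₁ (α j) ≤ V j) → (∀ j, 1 ≤ V j) → (∀ j, V j ≤ Vmax) →
    b ≠ 0 → (∀ j, Real.log (max 3 (|b j| : ℝ)) ≤ W) → 1 ≤ W →
    (padicValRat p (∏ j, α j ^ b j - 1) : ℝ) * Real.log p ≤
        C n * ((p : ℝ) / Real.log p) * (∏ j, V j) * (W + Real.log p + Real.log (2 * Vmax)) ∨
      StepOdd C p n α b V Vmax W

/-! ### The induction -/

/-- `0 ≤ p / log p` for a natural number `p` (`log p ≥ 0`). [folklore] -/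
theorem div_log_nonneg (p : ℕ) : 0 ≤ (p : ℝ) / Real.log p :=
  div_nonneg (Nat.cast_nonneg p) (Real.log_natCast_nonneg p)

/-- **Matveev's induction on the number of logarithms, odd `p`**: the per-rank dichotomy for every rank
gives the internal statement for every rank (strong induction; the step closes by the induction
hypothesis at the smaller rank, the valuation comparison and the cost inequality).
[cite: Nesterenko2003, Thm 2.1 from Prop 2.6] -/
theorem core_of_dichotomy {C : ℕ → ℝ} {p : ℕ} (hD : ∀ n, DichotomyOdd C p n) : ∀ r, CoreOdd C p r := by
  intro r
  induction r using Nat.strong_induction_on with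
  | _ n ih =>
    intro α b V Vmax W hα hind hK hV hV1 hVmax hb hW hW1
    rcases hD n α b V Vmax W hα hind hK hV hV1 hVmax hb hW hW1 with hle | hstep
    · exact hle
    · obtain ⟨r, θ, m, A, Amax, W', hr, hθ, hindθ, hKθ, hA, hA1, hAmax, hm, hW', hW1', hval, hcost⟩ :=
        hstep
      have hIH := ih r hr θ m A Amax W' hθ hindθ hKθ hA hA1 hAmax hm hW' hW1'
      have hlogp : 0 ≤ Real.log p := Real.log_natCast_nonneg p
      have hval' : (padicValRat p (∏ j, α j ^ b j - 1) : ℝ) * Real.log p ≤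
          (padicValRat p (∏ i, θ i ^ m i - 1) : ℝ) * Real.log p :=
        mul_le_mul_of_nonneg_right (by exact_mod_cast hval) hlogp
      have hcost' : C r * ((p : ℝ) / Real.log p) * (∏ i, A i) *
            (W' + Real.log p + Real.log (2 * Amax)) ≤
          C n * ((p : ℝ) / Real.log p) * (∏ j, V j) * (W + Real.log p + Real.log (2 * Vmax)) := by
        have h := mul_le_mul_of_nonneg_left hcost (div_log_nonneg p)
        calc C r * ((p : ℝ) / Real.log p) * (∏ i, A i) * (W' + Real.log p + Real.log (2 * Amax))
            = (p : ℝ) / Real.log p * (C r * (∏ i, A i) * (W' + Real.log p + Real.log (2 * Amax))) := by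
              ring
          _ ≤ (p : ℝ) / Real.log p * (C n * (∏ j, V j) * (W + Real.log p + Real.log (2 * Vmax))) := h
          _ = C n * ((p : ℝ) / Real.log p) * (∏ j, V j) * (W + Real.log p + Real.log (2 * Vmax)) := by
              ring
      exact hval'.trans (hIH.trans hcost')

/-- The frame's working form of the dichotomy at odd `p`: ASSUME the negated bound and produce the step.
[cite: Nesterenko2003, §5.2] -/
theorem dichotomyOdd_of_not_le {C : ℕ → ℝ} {p n : ℕ}
    (h : ∀ (α : Fin n → ℚ) (b : Fin n → ℤ) (V : Fin n → ℝ) (Vmax W : ℝ),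
      (∀ j, α j ≠ 0 ∧ padicValRat p (α j) = 0) →
      (∀ μ : Fin n → ℤ, ∏ j, α j ^ μ j = 1 → μ = 0) →
      (∀ κ : Fin n → ℤ, (∃ γ : ℚ, ∏ j, α j ^ κ j = γ ^ 2 ∨ ∏ j, α j ^ κ j = -γ ^ 2) →
        ∀ j, (2 : ℤ) ∣ κ j) →
      (∀ j, Height.logHeight₁ (α j) ≤ V j) → (∀ j, 1 ≤ V j) → (∀ j, V j ≤ Vmax) →
      b ≠ 0 → (∀ j, Real.log (max 3 (|b j| : ℝ)) ≤ W) → 1 ≤ W →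
      ¬ (padicValRat p (∏ j, α j ^ b j - 1) : ℝ) * Real.log p ≤
          C n * ((p : ℝ) / Real.log p) * (∏ j, V j) * (W + Real.log p + Real.log (2 * Vmax)) →
      StepOdd C p n α b V Vmax W) :
    DichotomyOdd C p n := by
  intro α b V Vmax W hα hind hK hV hV1 hVmax hb hW hW1
  by_cases hle : (padicValRat p (∏ j, α j ^ b j - 1) : ℝ) * Real.log p ≤
      C n * ((p : ℝ) / Real.log p) * (∏ j, V j) * (W + Real.log p + Real.log (2 * Vmax))
  · exact Or.inl hle
  · exact Or.inr (h α b V Vmax W hα hind hK hV hV1 hVmax hb hW hW1 hle)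

/-! ### Units, and the valuation comparison from the algebraic relation `∏ θᵐ = (∏ αᵇ)^{m₀}` -/

/-- Products of integer powers of `p`-adic units are `p`-adic units. [folklore] -/
theorem unit_prod_zpow {p : ℕ} [Fact p.Prime] {n : ℕ} (α : Fin n → ℚ)
    (hα : ∀ j, α j ≠ 0 ∧ padicValRat p (α j) = 0) (z : Fin n → ℤ) :
    ∏ j, α j ^ z j ≠ 0 ∧ padicValRat p (∏ j, α j ^ z j) = 0 := by
  refine ⟨Finset.prod_ne_zero_iff.mpr fun j _ => zpow_ne_zero _ (hα j).1, ?_⟩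
  rw [Literature.Barriers.ABC.padicValRat_finset_prod _ _ fun j _ => zpow_ne_zero _ (hα j).1]
  exact Finset.sum_eq_zero fun j _ => by rw [padicValRat.zpow, (hα j).2, mul_zero]

/-- For multiplicatively independent `αⱼ`, `b ≠ 0` and `m₀ ≠ 0`: `(∏ αⱼ^{bⱼ})^{m₀} ≠ 1`. [folklore] -/
theorem zpow_prod_zpow_ne_one {n : ℕ} (α : Fin n → ℚ)
    (hind : ∀ μ : Fin n → ℤ, ∏ j, α j ^ μ j = 1 → μ = 0) (b : Fin n → ℤ) (hb : b ≠ 0)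
    (m₀ : ℤ) (hm₀ : m₀ ≠ 0) : (∏ j, α j ^ b j) ^ m₀ ≠ 1 := by
  intro h1
  have h2 : ∏ j, α j ^ (m₀ * b j) = 1 := by
    rw [← h1, ← Finset.prod_zpow]
    refine Finset.prod_congr rfl fun j _ => ?_
    rw [← zpow_mul, mul_comm]
  have h3 := hind (fun j => m₀ * b j) h2
  apply hb
  funext j
  have h4 := congrFun h3 j
  simp only [Pi.zero_apply, mul_eq_zero] at h4
  rcases h4 with h4 | h4
  · exact absurd h4 hm₀
  · exact h4

/-- **The valuation comparison of a Matveev step at odd `p`**: if `∏ θᵢ^{mᵢ} = (∏ αⱼ^{bⱼ})^{m₀}` with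
`m₀ ≠ 0`, the `αⱼ` are `p`-adic units, multiplicatively independent, and `b ≠ 0`, then
`ord_p(∏ αᵇ − 1) ≤ ord_p(∏ θᵐ − 1)`. [cite: Nesterenko2003, Prop 2.6 (2.13)] -/
theorem padicValRat_le_of_pow_eq {p : ℕ} [Fact p.Prime] {n r : ℕ} (α : Fin n → ℚ)
    (hα : ∀ j, α j ≠ 0 ∧ padicValRat p (α j) = 0)
    (hind : ∀ μ : Fin n → ℤ, ∏ j, α j ^ μ j = 1 → μ = 0) (b : Fin n → ℤ) (hb : b ≠ 0)
    (θ : Fin r → ℚ) (m : Fin r → ℤ) (m₀ : ℤ) (hm₀ : m₀ ≠ 0)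
    (hrel : ∏ i, θ i ^ m i = (∏ j, α j ^ b j) ^ m₀) :
    padicValRat p (∏ j, α j ^ b j - 1) ≤ padicValRat p (∏ i, θ i ^ m i - 1) := by
  obtain ⟨hx0, hxv⟩ := unit_prod_zpow (p := p) α hα b
  rw [hrel]
  exact Literature.Barriers.ABC.padicValRat_sub_one_le_zpow_sub_one hx0 hxv hm₀
    (zpow_prod_zpow_ne_one α hind b hb m₀ hm₀)

/-- **The step from the algebraic relation, odd `p`**: rank-`r` data (`r < n`) satisfying the hypotheses
of `CoreOdd C p r`, the relation `∏ θᵐ = (∏ αᵇ)^{m₀}` (`m₀ ≠ 0`) and the cost inequality give `StepOdd`.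
This is the form in which the frame's END (`ZeroEnd.zeroEnd` ∘ `MatveevStepData.exists_matveev_step_data`
with `q = 2`, `θᵢ = ∏ αⱼ^{Zᵢⱼ}`, `m₀ b = ∑ mᵢ Zᵢ`) produces it. [cite: Nesterenko2003, Prop 2.6 (2.9)–(2.13)] -/
theorem stepOdd_of_pow_eq {C : ℕ → ℝ} {p : ℕ} [Fact p.Prime] {n : ℕ} {α : Fin n → ℚ} {b : Fin n → ℤ}
    {V : Fin n → ℝ} {Vmax W : ℝ} (hα : ∀ j, α j ≠ 0 ∧ padicValRat p (α j) = 0)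
    (hind : ∀ μ : Fin n → ℤ, ∏ j, α j ^ μ j = 1 → μ = 0) (hb : b ≠ 0)
    {r : ℕ} (hr : r < n) (θ : Fin r → ℚ) (m : Fin r → ℤ) (A : Fin r → ℝ) (Amax W' : ℝ)
    (hθ : ∀ i, θ i ≠ 0 ∧ padicValRat p (θ i) = 0)
    (hindθ : ∀ μ : Fin r → ℤ, ∏ i, θ i ^ μ i = 1 → μ = 0)
    (hKθ : ∀ κ : Fin r → ℤ, (∃ γ : ℚ, ∏ i, θ i ^ κ i = γ ^ 2 ∨ ∏ i, θ i ^ κ i = -γ ^ 2) →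
      ∀ i, (2 : ℤ) ∣ κ i)
    (hA : ∀ i, Height.logHeight₁ (θ i) ≤ A i) (hA1 : ∀ i, 1 ≤ A i) (hAmax : ∀ i, A i ≤ Amax)
    (hW' : ∀ i, Real.log (max 3 (|m i| : ℝ)) ≤ W') (hW1' : 1 ≤ W')
    (m₀ : ℤ) (hm₀ : m₀ ≠ 0) (hrel : ∏ i, θ i ^ m i = (∏ j, α j ^ b j) ^ m₀)
    (hcost : C r * (∏ i, A i) * (W' + Real.log p + Real.log (2 * Amax)) ≤
      C n * (∏ j, V j) * (W + Real.log p + Real.log (2 * Vmax))) :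
    StepOdd C p n α b V Vmax W := by
  -- `m ≠ 0`: otherwise `(∏ αᵇ)^{m₀} = ∏ θ⁰ = 1`
  have hm : m ≠ 0 := by
    intro hm0
    apply zpow_prod_zpow_ne_one α hind b hb m₀ hm₀
    rw [← hrel, hm0]
    simp
  exact ⟨r, θ, m, A, Amax, W', hr, hθ, hindθ, hKθ, hA, hA1, hAmax, hm, hW', hW1',
    padicValRat_le_of_pow_eq α hα hind b hb θ m m₀ hm₀ hrel, hcost⟩

end Summit.ABC.StewartYu.GenThreeInductionOdd

end
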